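import Literature.Probability.LatticeModels.HighDimTrivialityPrintRegimeProofs
import Literature.Probability.LatticeModels.ImprovedTreeDiagramBoundHolds
import HarnessLib

/-!
# High-dimensional triviality of Ising scaling limits: the discharge of crit-ising.S13 in the printed regime

Topic `Literature/Probability/LatticeModels`; family `crit-ising`. Discharge (librarian,
fact-decomposition pass of 2026-08-16; pure composition, no definition, no named fact) of the
named fact
`Literature.Probability.LatticeModels.isGaussianProcess_of_tendstoInDistribution_smearedSpin_printRegime`
(`HighDimTriviality.lean`: every scaling limit in law of the rescaled nearest-neighbour Ising spin
field on `ℤ^d`, `d ≥ 4`, in the regime covered by print, is a Gaussian process): the tree reduced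
it to Aizenman–Duminil-Copin 2021, Thm 1.3 alone
(`isGaussianProcess_of_tendstoInDistribution_smearedSpin_printRegime_of_improvedTreeDiagramBound`,
`HighDimTrivialityPrintRegimeProofs.lean`), and that theorem is now discharged
(`aizenmanDuminilCopin_improvedTreeDiagramBound_holds`, `ImprovedTreeDiagramBoundHolds.lean`).
No split is needed. Separate file for the same import-cycle reason as
`HighDimTrivialityPanisFourHolds.lean`.

## References

* M. Aizenman, H. Duminil-Copin, *Marginal triviality of the scaling limits of critical 4D Ising
  and φ⁴₄ models*, Ann. of Math. 194 (2021), arXiv:1912.07973, Thm 1.3 and Prop. 1.4 (p. 6),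
  §6.3 (pp. 26–27). [AizenmanDuminilCopinAnnals2021]
* R. Panis, arXiv:2309.05797 (Ann. Probab. 54, 2026), Thm 5.5, Cor. 1.8. [Panis2023Triviality]
-/

noncomputable section

namespace Literature.Probability.LatticeModels

universe u

/-- **crit-ising.S13 in the printed regime holds**: discharge of the named fact
`isGaussianProcess_of_tendstoInDistribution_smearedSpin_printRegime`, from the tree's reduction to
the improved tree diagram bound and the discharge of the latter.
[cite: AizenmanDuminilCopinAnnals2021, arXiv:1912.07973 Thm 1.3 and Prop. 1.4 (p. 6)]
[cite: Panis2023Triviality, Thm 5.5 and Cor. 1.8] -/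
theorem isGaussianProcess_of_tendstoInDistribution_smearedSpin_printRegime_holds :
    isGaussianProcess_of_tendstoInDistribution_smearedSpin_printRegime.{u} :=
  isGaussianProcess_of_tendstoInDistribution_smearedSpin_printRegime_of_improvedTreeDiagramBound
    aizenmanDuminilCopin_improvedTreeDiagramBound_holds

end Literature.Probability.LatticeModels

end
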